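import Summits.QuantumFields.YangMills.Theorems.BalabanLadderUVSeamRecCeilingsGuardedPeelingSlices
import Summits.QuantumFields.YangMills.Theorems.BalabanLadderUVSeamRecCeilingsGuardedPeelingArithmetic
import HarnessLib

/-!
# Crux `UVSeamRec` (stmt-QuantumFields-20043), lane B: doubled exponential moments of the influence functionals from the GUARDED one-box
# bound (GUCR) — linear budget, no threshold floor tied to the collar

Helper file (`--supports stmt-QuantumFields-20043`) of the width-lever seat `ym-20043-ceilings-p2` (lane B, gen 9); sequel of
`…CeilingsGuardedPeelingSlices` and `…CeilingsGuardedPeelingArithmetic`.  gen 8's `torusE_exp_two_mul_sum_influence_le_of_uniformConditionalRarity_linear`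
(p587031) with the UNGUARDED one-box bound (UCR_k) replaced by the GUARDED one (GUCR_k): for every level `k ≥ 1`, threshold `e ≥ ε_k`, block index `z`,
orientation `μ<ν` and EVERY exterior `η`, `kerE^η_{(b^{k+s}(z/b^s − m), (2m+1)b^{k+s})}(1_{largeFieldEvent e (k,z,μν) ∖ largeFieldEvent (ρe) (k+s, z/b^s, μν)}) ≤ w_k`
(the level-`k` block plaquette is `e`-large while its b-adic `s`-parent is NOT `ρe`-large; kernel over the collar cube of the PARENT), with the schedule
conditions `ε_{k+s} ≤ ρ·ε_k` and `ρ^J·ε_k > 2` (every parent chain is empty after `J` steps, `blockField ≤ 2`).  THE POINT: an exterior that forces a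
COHERENT flux through a cube excites the parent block plaquette by `≈ b^{4s}` more than the child, so for `ρ` below that factor the guarded event is not
produced by penetration — the threshold floor `ε₀` is decoupled from the collar `m` (gen 6/7 recorded `ε ≳ π⁴/(2(2m+1)⁴)` for (UCR)); the price is the
number of chain steps `J = O(log(2/ε₀)/log ρ)` in the constants, NOT a `log R`.
* `torusE_exp_two_mul_sum_influence_le_of_guardedConditionalRarity` — fundamental `SU(N)`, odd torus `2L+1`, `β ≥ 1`, REDUCED `2R+4`-separated family,
  ANY odd block size, ANY collar `m ≥ 3`, guard depth `s`, `J ≥ 1` steps, ratio `ρ ≥ 0`: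
  `⟨exp(2Σ_{i∈T} influence 𝔟 ε kmax R (x i)∘lift)⟩ ≤ exp((3072·J·(m+4+2Js+J) + 2(e−1)·1536·(δ₀(β) + J·Σ_{1≤k≤kmax} w_k))·#T)`.
  Proof: telescope every level-`k ≥ 1` indicator into `J` guarded ones (`indicator_largeFieldEvent_le_sum_guarded`); Hölder across the ORIGIN levels
  with gen 8's geometric exponents; deep levels (depth `≥ m+4+2Js+J`) by `guarded_slice_exp_moment_deep`, the others trivially; level `0` as in gen 8.
HONEST FRAMING.  Folklore probability; (GUCR_k) is an OPEN one-box large-field input of Bałaban's kind (R-operation currency, Dirichlet data in the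
parent's collar cube) — its freedom from the penetration floor is a heuristic (uniform-flux scaling), not proved; nothing of E0′; not a gap, not Clay.
References: folklore; T. Bałaban, Commun. Math. Phys. 122 (1989) 175–202, 355–392.
-/

set_option autoImplicit false

noncomputable section

open MeasureTheory Filter Topology Finset
open Literature.Probability.LatticeModels
open Literature.MathematicalPhysics.QuantumFieldTheory (GaugeConfig wilsonMeasure LatticeRep isProbabilityMeasure_wilsonMeasure
  measurable_torusLift)
open Literature.MathematicalPhysics.QuantumLattice (LGConfig torusLift IsCylinder ymSpecification isProbabilityMeasure_ymSpecification
  integrable_of_abs_le fundamentalLatticeRep)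

namespace Summit.QuantumFields.YangMills.Cruxes.UVSeamRec.DLRPeeling

open Summit.QuantumFields.YangMills.Cruxes.OSLegsFromFemtoAndGap.DlrCollarTransfer
open Summit.QuantumFields.YangMills.Cruxes.UVSeamRec.PolymerData
open Summit.QuantumFields.YangMills.Cruxes.UVSeamRec.TemperedResponse
open Summit.QuantumFields.YangMills.Cruxes.UVSeamRec.BlockFieldLocality
open Summit.QuantumFields.YangMills.Theorems.OddTorusChessboard (Orient)

/-! ## The doubled moments from (GUCR) -/

section Guarded

variable {N : ℕ} [NeZero N]

/-- **DOUBLED JOINT EXPONENTIAL MOMENTS OF THE INFLUENCE FUNCTIONALS FROM THE GUARDED ONE-BOX BOUND (GUCR), LINEAR BUDGET.**  Fundamental Wilson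
state of `SU(N)` on the odd torus `2L+1`, `β ≥ 1`; a REDUCED cube family (`|x i c| ≤ L`), pairwise cyclically `2R+4`-separated, `1 ≤ R`, `4R+8 ≤ L`;
ANY odd block size `𝔟`, ANY collar `m ≥ 3`, guard depth `s`, `J ≥ 1` chain steps, ratio `ρ ≥ 0`, thresholds `ε` with `2 < ρ^J·ε_k` and
`ε_{k+s} ≤ ρ·ε_k`, cutoff `kmax`; weights `w_k ≥ 0` with (GUCR_k) at every level `k ≥ 1` and every threshold `e ≥ ε_k`:
`∀ z μ<ν η, kerE^η_{(b^{k+s}(z/b^s − m), (2m+1)b^{k+s})}(1_{largeFieldEvent e (k,z,μν) ∖ largeFieldEvent (ρe) (k+s, z/b^s, μν)}) ≤ w_k`.  THEN, with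
the constants `K₀, D₁` of the proved level-`0` law, for every `T`,
`⟨exp(2 Σ_{i∈T} influence 𝔟 ε kmax R (x i)∘lift)⟩_{2L+1,β} ≤ exp((3072·J·(m+4+2Js+J) + 2(e−1)·1536·(δ₀ + J·Σ_{1≤k≤kmax} w_k))·#T)`,
`δ₀ = exp(−βNε₀/#Orient + (K₀ + D₁ log β)/#Orient)`.  No RP, no divisibility, every block size, every collar, and NO coupling of the thresholds to
the collar.  HONEST FRAMING: reduction; (GUCR) is the open input. [folklore] -/
theorem torusE_exp_two_mul_sum_influence_le_of_guardedConditionalRarity :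
    ∃ K₀ : ℝ, ∃ D₁ : ℕ, ∀ (𝔟 : BlockSize) (m : ℕ), 3 ≤ m → ∀ (s J : ℕ), 1 ≤ J → ∀ (ρ : ℝ), 0 ≤ ρ →
      ∀ (ε : ℕ → ℝ), (∀ k, 2 < ρ ^ J * ε k) → (∀ k, ε (k + s) ≤ ρ * ε k) →
      ∀ (kmax R L : ℕ) (β : ℝ), 1 ≤ β →
      ∀ {n : ℕ} (x : Fin n → (Fin 4 → ℤ)), 1 ≤ R → 4 * R + 8 ≤ L → (∀ i c, |x i c| ≤ (L : ℤ)) →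
      (∀ i j : Fin n, i ≠ j → ∃ k : Fin 4,
        (2 * (R : ℤ) + 4) ≤ |((((x i k - x j k : ℤ) : ZMod (2 * L + 1))).valMinAbs : ℤ)|) →
      ∀ (w : ℕ → ℝ), (∀ k, 0 ≤ w k) →
      (∀ k : ℕ, 1 ≤ k → ∀ e : ℝ, ε k ≤ e → ∀ (z : Fin 4 → ℤ) (μ ν : Fin 4) (h : μ < ν)
        (η : LGConfig 4 (Matrix.specialUnitaryGroup (Fin N) ℂ)),
        kerE (Matrix.specialUnitaryGroup (Fin N) ℂ) (fundamentalLatticeRep N) β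
          (fun c => (𝔟.b : ℤ) ^ (k + s) * (z c / (𝔟.b : ℤ) ^ s - m)) ((2 * m + 1) * 𝔟.b ^ (k + s)) η
          ((largeFieldEvent (N := N) 𝔟 e ⟨k, z, μ, ν, h⟩ \
            largeFieldEvent (N := N) 𝔟 (ρ * e) ⟨k + s, fun c => z c / (𝔟.b : ℤ) ^ s, μ, ν, h⟩).indicator fun _ => (1 : ℝ)) ≤ w k) →
      ∀ T : Finset (Fin n),
        torusE (Matrix.specialUnitaryGroup (Fin N) ℂ) (fundamentalLatticeRep N) β L
            (fun U => Real.exp (((2 : ℕ) : ℝ) * ∑ i ∈ T, influence (N := N) 𝔟 ε kmax R (x i) U)) ≤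
          Real.exp ((3072 * (J : ℝ) * ((m : ℝ) + 4 + 2 * J * s + J) + 2 * (Real.exp 1 - 1) * 1536 *
            (Real.exp (-(β * ((N : ℝ) * ε 0)) / Fintype.card (Orient 4) + (K₀ + D₁ * Real.log β) / Fintype.card (Orient 4)) +
              J * ∑ k ∈ (Finset.range (kmax + 1)).filter (fun k => 1 ≤ k), w k)) * T.card) := by
  classical
  obtain ⟨K₀, D₁, hPL0⟩ := torusE_exp_sum_indicator_levelZero_le (N := N)
  refine ⟨K₀, D₁, ?_⟩
  intro 𝔟 m hm s J hJ ρ hρ ε hJε hsched kmax R L β hβ n x hR hRL hred hsep w hw0 hGUCR T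
  haveI := isProbabilityMeasure_wilsonMeasure (d := 4) (L := 2 * L + 1) (fundamentalLatticeRep N).ρ (fundamentalLatticeRep N).continuous β
  have hL : 1 ≤ L := by omega
  set μT := wilsonMeasure (d := 4) (L := 2 * L + 1) (fundamentalLatticeRep N).ρ β with hμT
  set δ₀ : ℝ := Real.exp (-(β * ((N : ℝ) * ε 0)) / Fintype.card (Orient 4) + (K₀ + D₁ * Real.log β) / Fintype.card (Orient 4))
    with hδ₀def
  have hδ₀0 : 0 ≤ δ₀ := (Real.exp_pos _).le
  set cD : ℝ := 2 * (Real.exp 1 - 1) * 1536 with hcDdef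
  have he1 : 1 ≤ Real.exp 1 - 1 := by have := Real.add_one_le_exp (1 : ℝ); linarith
  have hcD0 : 0 ≤ cD := by rw [hcDdef]; nlinarith
  set Wsum : ℝ := ∑ k ∈ (Finset.range (kmax + 1)).filter (fun k => 1 ≤ k), w k with hWsum
  have hW0 : 0 ≤ Wsum := Finset.sum_nonneg fun k _ => hw0 k
  have hJ1 : (1 : ℝ) ≤ J := by exact_mod_cast hJ
  have hJ0 : (0 : ℝ) ≤ J := by linarith
  have hT0 : (0 : ℝ) ≤ T.card := Nat.cast_nonneg _
  set dtr : ℕ := m + 3 + 2 * J * s + J with hdtr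
  have hB0 : 0 ≤ (3072 * (J : ℝ) * ((m : ℝ) + 4 + 2 * J * s + J) + cD * (δ₀ + J * Wsum)) * T.card :=
    mul_nonneg (add_nonneg (by positivity) (mul_nonneg hcD0 (add_nonneg hδ₀0 (mul_nonneg hJ0 hW0)))) hT0
  let S : ℕ → Finset Polymer := fun k => (familyShell 𝔟 kmax R x).filter (fun γ => γ.k = k)
  have hSk : ∀ k, ∀ γ ∈ S k, γ.k = k := fun k γ hγ => (Finset.mem_filter.1 hγ).2
  have hSsub : ∀ k, S k ⊆ familyShell 𝔟 kmax R x := fun k => Finset.filter_subset _ _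
  let a : Polymer → ℝ := fun γ => ∑ i ∈ T, familyCoeff 𝔟 kmax R x i γ
  have ha0 : ∀ γ, 0 ≤ a γ := fun γ => Finset.sum_nonneg fun i _ => familyCoeff_nonneg 𝔟 kmax R x i γ
  have hacap : ∀ γ, a γ ≤ 16 * ((𝔟.b : ℝ) ^ γ.k / ((R : ℝ) + 2 + 2 * (𝔟.b : ℝ) ^ γ.k)) ^ 4 := fun γ =>
    (Finset.sum_le_univ_sum_of_nonneg fun i => familyCoeff_nonneg 𝔟 kmax R x i γ).trans
      (sum_familyCoeff_le_levelCap' 𝔟 kmax R hRL x hsep γ)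
  have hmass : ∀ k, ∑ γ ∈ S k, a γ ≤ 1536 * T.card := by
    intro k
    calc ∑ γ ∈ S k, a γ = ∑ i ∈ T, ∑ γ ∈ S k, familyCoeff 𝔟 kmax R x i γ := Finset.sum_comm
      _ ≤ ∑ _i ∈ T, (1536 : ℝ) := Finset.sum_le_sum fun i _ => sum_familyCoeff_slice_le 𝔟 kmax R x i k (S k) (hSk k)
      _ = 1536 * T.card := by rw [Finset.sum_const, nsmul_eq_mul, mul_comm]
  let G : ℕ → ℕ → Polymer → Set (LGConfig 4 (Matrix.specialUnitaryGroup (Fin N) ℂ)) := fun k j γ =>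
    largeFieldEvent (N := N) 𝔟 (ρ ^ j * ε k) ⟨k + j * s, fun c => γ.y c / (𝔟.b : ℤ) ^ (j * s), γ.μ, γ.ν, γ.hμν⟩ \
      largeFieldEvent (N := N) 𝔟 (ρ ^ (j + 1) * ε k) ⟨k + (j + 1) * s, fun c => γ.y c / (𝔟.b : ℤ) ^ ((j + 1) * s), γ.μ, γ.ν, γ.hμν⟩
  have hGm : ∀ k j γ, MeasurableSet (G k j γ) := fun k j γ => measurableSet_guarded (N := N) 𝔟 _ _ _ _
  have hχ01 : ∀ (E : Set (LGConfig 4 (Matrix.specialUnitaryGroup (Fin N) ℂ))) (U : LGConfig 4 (Matrix.specialUnitaryGroup (Fin N) ℂ)),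
      0 ≤ E.indicator (fun _ => (1 : ℝ)) U ∧ E.indicator (fun _ => (1 : ℝ)) U ≤ 1 := fun E U =>
    ⟨Set.indicator_nonneg (fun _ _ => zero_le_one) _, Set.indicator_apply_le' (fun _ => le_rfl) (fun _ => zero_le_one)⟩
  -- the level functionals: native at level `0`, telescoped at the levels `k ≥ 1`
  let Jn : GaugeConfig 4 (2 * L + 1) (Matrix.specialUnitaryGroup (Fin N) ℂ) → ℝ := fun U =>
    ∑ γ ∈ S 0, a γ * (largeFieldEvent (N := N) 𝔟 (ε 0) γ).indicator (fun _ => (1 : ℝ)) (torusLift (2 * L + 1) U)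
  let Jg : ℕ → GaugeConfig 4 (2 * L + 1) (Matrix.specialUnitaryGroup (Fin N) ℂ) → ℝ := fun k U =>
    ∑ γ ∈ S k, a γ * ∑ j ∈ Finset.range J, (G k j γ).indicator (fun _ => (1 : ℝ)) (torusLift (2 * L + 1) U)
  let Jf : ℕ → GaugeConfig 4 (2 * L + 1) (Matrix.specialUnitaryGroup (Fin N) ℂ) → ℝ := fun k U =>
    if k = 0 then Jn U else Jg k U
  have hJnm : Measurable Jn := Finset.measurable_sum _ fun γ _ =>
    ((measurable_const.indicator (measurableSet_largeFieldEvent (N := N) 𝔟 _ γ)).comp (measurable_torusLift _)).const_mul _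
  have hJgm : ∀ k, Measurable (Jg k) := fun k => Finset.measurable_sum _ fun γ _ =>
    (Finset.measurable_sum _ fun j _ => (measurable_const.indicator (hGm k j γ)).comp (measurable_torusLift _)).const_mul _
  have hJfm : ∀ k, Measurable (Jf k) := by
    intro k
    by_cases hk : k = 0
    · have : Jf k = Jn := funext fun U => if_pos hk
      rw [this]; exact hJnm
    · have : Jf k = Jg k := funext fun U => if_neg hk
      rw [this]; exact hJgm k
  have hJn0 : ∀ U, 0 ≤ Jn U := fun U => Finset.sum_nonneg fun γ _ => mul_nonneg (ha0 γ) (hχ01 _ _).1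
  have hJnle : ∀ U, Jn U ≤ (J : ℝ) * (1536 * T.card) := by
    intro U
    have h1 : Jn U ≤ 1536 * T.card :=
      (Finset.sum_le_sum fun γ _ => by simpa using mul_le_mul_of_nonneg_left (hχ01 _ (torusLift (2 * L + 1) U)).2 (ha0 γ)).trans
        (hmass 0)
    have h2 : (1536 : ℝ) * T.card ≤ J * (1536 * T.card) := le_mul_of_one_le_left (by positivity) hJ1
    exact h1.trans h2
  have hsumχ : ∀ k γ (U : LGConfig 4 (Matrix.specialUnitaryGroup (Fin N) ℂ)),
      0 ≤ ∑ j ∈ Finset.range J, (G k j γ).indicator (fun _ => (1 : ℝ)) U ∧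
        ∑ j ∈ Finset.range J, (G k j γ).indicator (fun _ => (1 : ℝ)) U ≤ J := by
    intro k γ U
    refine ⟨Finset.sum_nonneg fun j _ => (hχ01 _ _).1, ?_⟩
    calc ∑ j ∈ Finset.range J, (G k j γ).indicator (fun _ => (1 : ℝ)) U ≤ ∑ _j ∈ Finset.range J, (1 : ℝ) :=
          Finset.sum_le_sum fun j _ => (hχ01 _ _).2
      _ = J := by simp
  have hJg0 : ∀ k U, 0 ≤ Jg k U := fun k U => Finset.sum_nonneg fun γ _ => mul_nonneg (ha0 γ) (hsumχ k γ _).1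
  have hJgle : ∀ k U, Jg k U ≤ (J : ℝ) * (1536 * T.card) := by
    intro k U
    calc Jg k U ≤ ∑ γ ∈ S k, a γ * J := Finset.sum_le_sum fun γ _ => mul_le_mul_of_nonneg_left (hsumχ k γ _).2 (ha0 γ)
      _ = J * ∑ γ ∈ S k, a γ := by rw [← Finset.sum_mul, mul_comm]
      _ ≤ J * (1536 * T.card) := mul_le_mul_of_nonneg_left (hmass k) hJ0
  have hJf0 : ∀ k U, 0 ≤ Jf k U := fun k U => by
    by_cases hk : k = 0
    · simp only [Jf, hk, if_true]; exact hJn0 U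
    · simp only [Jf, hk, if_false]; exact hJg0 k U
  have hJfle : ∀ k U, Jf k U ≤ (J : ℝ) * (1536 * T.card) := fun k U => by
    by_cases hk : k = 0
    · simp only [Jf, hk, if_true]; exact hJnle U
    · simp only [Jf, hk, if_false]; exact hJgle k U
  have hJfb : ∀ k U, |Jf k U| ≤ (J : ℝ) * (1536 * T.card) := fun k U => by rw [abs_of_nonneg (hJf0 k U)]; exact hJfle k U
  -- DOMINATION: the sliced influence functional is below the telescoped one
  have hdom : ∀ U : GaugeConfig 4 (2 * L + 1) (Matrix.specialUnitaryGroup (Fin N) ℂ),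
      ∑ i ∈ T, influence (N := N) 𝔟 ε kmax R (x i) (torusLift (2 * L + 1) U) ≤ ∑ k ∈ Finset.range (kmax + 1), Jf k U := by
    intro U
    rw [sum_influence_eq_sum_slices (N := N) 𝔟 ε kmax R x T]
    refine Finset.sum_le_sum fun k _ => ?_
    by_cases hk : k = 0
    · subst hk
      simp only [Jf, if_true, Jn]
      refine le_of_eq (Finset.sum_congr rfl fun γ hγ => ?_)
      rw [(Finset.mem_filter.1 hγ).2]
    · simp only [Jf, hk, if_false, Jg]
      refine Finset.sum_le_sum fun γ hγ => ?_
      have hγk : γ.k = k := (Finset.mem_filter.1 hγ).2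
      have h := indicator_largeFieldEvent_le_sum_guarded (N := N) 𝔟 s J (hJε k) γ (torusLift (2 * L + 1) U)
      rw [hγk] at h ⊢
      exact mul_le_mul_of_nonneg_left h (ha0 γ)
  -- the left-hand side is below the telescoped moment
  have hlhs : torusE (Matrix.specialUnitaryGroup (Fin N) ℂ) (fundamentalLatticeRep N) β L
      (fun U => Real.exp (((2 : ℕ) : ℝ) * ∑ i ∈ T, influence (N := N) 𝔟 ε kmax R (x i) U)) ≤
      ∫ U, Real.exp (2 * ∑ k ∈ Finset.range (kmax + 1), Jf k U) ∂μT := by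
    unfold torusE
    have hbd : ∀ U, Real.exp (2 * ∑ k ∈ Finset.range (kmax + 1), Jf k U) ≤
        Real.exp (2 * ((kmax + 1 : ℕ) * ((J : ℝ) * (1536 * T.card)))) := by
      intro U
      refine Real.exp_le_exp.2 (mul_le_mul_of_nonneg_left ?_ zero_le_two)
      calc ∑ k ∈ Finset.range (kmax + 1), Jf k U ≤ ∑ _k ∈ Finset.range (kmax + 1), (J : ℝ) * (1536 * T.card) :=
            Finset.sum_le_sum fun k _ => hJfle k U
        _ = (kmax + 1 : ℕ) * ((J : ℝ) * (1536 * T.card)) := by rw [Finset.sum_const, Finset.card_range, nsmul_eq_mul]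
    refine integral_mono_of_nonneg (ae_of_all _ fun U => (Real.exp_pos _).le) ?_ (ae_of_all _ fun U => ?_)
    · exact integrable_of_abs_le ((Finset.measurable_sum _ fun k _ => hJfm k).const_mul _).exp
        (C := Real.exp (2 * ((kmax + 1 : ℕ) * ((J : ℝ) * (1536 * T.card))))) fun U => by rw [Real.abs_exp]; exact hbd U
    · simp only [Nat.cast_ofNat]
      exact Real.exp_le_exp.2 (mul_le_mul_of_nonneg_left (hdom U) zero_le_two)
  refine hlhs.trans ?_
  -- Case: no shell polymers at all
  by_cases hR2 : 2 * 𝔟.b ^ 0 ≤ R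
  swap
  · have hempty : ∀ k, S k = ∅ := by
      intro k
      refine Finset.eq_empty_of_forall_notMem fun γ hγ => ?_
      obtain ⟨i, _, hi⟩ := Finset.mem_biUnion.1 (hSsub k hγ)
      have hsh := (mem_shell_iff 𝔟 kmax R (x i) γ).1 hi
      have h2 : 2 * 𝔟.b ^ γ.k ≤ R := by have := hsh.2.1.trans hsh.2.2; omega
      have h1 : 𝔟.b ^ 0 ≤ 𝔟.b ^ γ.k := Nat.pow_le_pow_right 𝔟.pos (Nat.zero_le _)
      exact hR2 (by omega)
    have hJ : ∀ k U, Jf k U = 0 := fun k U => by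
      by_cases hk : k = 0
      · simp only [Jf, hk, if_true, Jn, hempty, Finset.sum_empty]
      · simp only [Jf, hk, if_false, Jg, hempty, Finset.sum_empty]
    simp only [hJ, Finset.sum_const_zero, mul_zero, Real.exp_zero, integral_const, smul_eq_mul, mul_one, probReal_univ]
    exact Real.one_le_exp hB0
  -- the top shell level `K`
  set K : ℕ := Nat.findGreatest (fun k => 2 * 𝔟.b ^ k ≤ R) kmax with hKdef
  have hK2 : 2 * 𝔟.b ^ K ≤ R := Nat.findGreatest_spec (P := fun k => 2 * 𝔟.b ^ k ≤ R) (Nat.zero_le kmax) hR2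
  have hKle : K ≤ kmax := Nat.findGreatest_le kmax
  have hSempty : ∀ k, K < k → k ≤ kmax → S k = ∅ := by
    intro k hk hk'
    refine Finset.eq_empty_of_forall_notMem fun γ hγ => ?_
    obtain ⟨i, _, hi⟩ := Finset.mem_biUnion.1 (hSsub k hγ)
    have hsh := (mem_shell_iff 𝔟 kmax R (x i) γ).1 hi
    have h2 : 2 * 𝔟.b ^ γ.k ≤ R := by have := hsh.2.1.trans hsh.2.2; omega
    rw [hSk k γ hγ] at h2
    exact Nat.findGreatest_is_greatest (P := fun k => 2 * 𝔟.b ^ k ≤ R) hk hk' h2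
  have hzero : ∀ k, K < k → k ≤ kmax → ∀ U, Jf k U = 0 := by
    intro k hk hk' U
    have hk0 : k ≠ 0 := by omega
    simp only [Jf, hk0, if_false, Jg, hSempty k hk hk', Finset.sum_empty]
  -- the budget per level: `g` = the weights on `[1, kmax]`, `θ k` = the deep-level budget
  let g : ℕ → ℝ := fun l => if 1 ≤ l ∧ l ≤ kmax then w l else 0
  have hg0 : ∀ l, 0 ≤ g l := fun l => by by_cases h : 1 ≤ l ∧ l ≤ kmax <;> simp [g, h, hw0]
  have hgle : ∀ M, ∑ l ∈ Finset.range M, g l ≤ Wsum := by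
    intro M
    rw [hWsum]
    have h1 : ∑ l ∈ Finset.range M, g l = ∑ l ∈ (Finset.range M).filter (fun l => 1 ≤ l ∧ l ≤ kmax), w l := by
      rw [Finset.sum_filter]
    rw [h1]
    refine Finset.sum_le_sum_of_subset_of_nonneg (fun l hl => ?_) fun l _ _ => hw0 l
    have h := (Finset.mem_filter.1 hl).2
    exact Finset.mem_filter.2 ⟨Finset.mem_range.2 (by omega), h.1⟩
  let θ : ℕ → ℝ := fun k => if k = 0 then δ₀ else ∑ j ∈ Finset.range J, g (k + j * s)
  have hθ0 : ∀ k, 0 ≤ θ k := fun k => by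
    by_cases hk : k = 0
    · simp only [θ, hk, if_true]; exact hδ₀0
    · simp only [θ, hk, if_false]; exact Finset.sum_nonneg fun j _ => hg0 _
  let C : ℕ → ℝ := fun d => if d ≤ dtr then 3072 * (J : ℝ) * T.card else cD * θ (K - d) * T.card
  -- the level-`0` window law (proved plaquette law, exponential currency)
  have hWF0 : ∀ (o : Fin 4 → ℤ) (A : Finset Polymer), A ⊆ familyShell 𝔟 kmax R x → (∀ γ ∈ A, γ.k = 0) →
      (∀ γ ∈ A, ∀ c, o c ≤ anchor 𝔟 γ c ∧ anchor 𝔟 γ c + (𝔟.b : ℤ) ^ (0 : ℕ) ≤ o c + (2 * L + 1)) →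
      ∀ t : Polymer → ℝ, (∀ γ ∈ A, 0 ≤ t γ) →
      torusE (Matrix.specialUnitaryGroup (Fin N) ℂ) (fundamentalLatticeRep N) β L (fun U => Real.exp (∑ γ ∈ A,
        t γ * (largeFieldEvent (N := N) 𝔟 (ε 0) γ).indicator (fun _ => (1 : ℝ)) U)) ≤
        Real.exp (1 / (1 : ℝ) * ∑ γ ∈ A, (Real.exp ((1 : ℝ) * t γ) - 1) * δ₀) := by
    intro o A _ hA hwin t ht
    have h := hPL0 𝔟 (ε 0) L hL β hβ o A hA hwin t ht
    simpa only [one_mul, div_one, hδ₀def] using h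
  -- per-level Hölder bounds
  have hmom : ∀ d, d ≤ K → ∫ U, Real.exp ((2 : ℝ) ^ (d + 1) * (2 * Jf (K - d) U)) ∂μT ≤ Real.exp ((2 : ℝ) ^ (d + 1) * C d) := by
    intro d hdK
    set k := K - d with hkdef
    have hkd : k + d = K := by omega
    have hc : (0 : ℝ) ≤ (2 : ℝ) ^ (d + 1) * 2 := by positivity
    have hassoc : ∀ U, (2 : ℝ) ^ (d + 1) * (2 * Jf k U) = (2 : ℝ) ^ (d + 1) * 2 * Jf k U := fun U => by ring
    simp only [hassoc]
    by_cases htop : d ≤ dtr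
    · -- trivial bound by the coefficient mass
      have hCd : C d = 3072 * (J : ℝ) * T.card := if_pos htop
      rw [hCd, show (2 : ℝ) ^ (d + 1) * (3072 * (J : ℝ) * (T.card : ℝ)) = (2 : ℝ) ^ (d + 1) * 2 * ((J : ℝ) * (1536 * T.card)) by ring]
      exact integral_exp_le_exp_of_le μT (hJfm k) (hJfle k) hc
    have hdeep : m + 4 + 2 * J * s + J ≤ d := by rw [hdtr] at htop; omega
    have hCd : C d = cD * θ k * T.card := by simp only [C, if_neg htop, hkdef]
    rw [hCd]
    by_cases hk0 : k = 0
    · -- level `0`: gen 8's path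
      have hθk : θ k = δ₀ := by simp only [θ, hk0, if_true]
      have hJk : ∀ U, Jf k U = Jn U := fun U => if_pos hk0
      simp only [hJk]
      have hsmall0 : ∀ γ ∈ (familyShell 𝔟 kmax R x).filter (fun γ => γ.k = 0),
          16 * (1 : ℝ) * ((2 : ℝ) ^ (d + 1) * 2 * ∑ i ∈ T, familyCoeff 𝔟 kmax R x i γ) ≤ 1 := by
        intro γ hγ
        have h1 := hacap γ
        rw [(Finset.mem_filter.1 hγ).2] at h1
        rw [hk0] at hkd
        have hdw := deep_weight_le_one 𝔟 hm hK2 hkd (by omega : m + 4 ≤ d) h1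
        have h0 : 0 ≤ (2 : ℝ) ^ (d + 1) * 2 * a γ := mul_nonneg hc (ha0 γ)
        have hK'1 : (1 : ℝ) ≤ 256 * (2 * (m : ℝ) + 4) ^ 4 := by
          have : (1 : ℝ) ≤ (2 * (m : ℝ) + 4) ^ 4 := one_le_pow₀ (by linarith)
          nlinarith
        calc 16 * (1 : ℝ) * ((2 : ℝ) ^ (d + 1) * 2 * a γ) ≤ 16 * (256 * (2 * (m : ℝ) + 4) ^ 4) * ((2 : ℝ) ^ (d + 1) * 2 * a γ) := by
              refine mul_le_mul_of_nonneg_right ?_ h0; linarith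
          _ ≤ 1 := hdw
      have h := slice_exp_moment_deep (N := N) β 𝔟 (ε 0) kmax R L 0 hRL x hred T one_pos hδ₀0 hWF0 hc hsmall0
      rw [hθk, show (2 : ℝ) ^ (d + 1) * (cD * δ₀ * (T.card : ℝ)) = (2 : ℝ) ^ (d + 1) * 2 * ((Real.exp 1 - 1) * 1536 * δ₀ * T.card) by
        rw [hcDdef]; ring]
      exact h
    · -- level `k ≥ 1`: the guarded deep slice
      have hk1 : 1 ≤ k := Nat.one_le_iff_ne_zero.2 hk0
      have hJk : ∀ U, Jf k U = Jg k U := fun U => if_neg hk0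
      simp only [hJk]
      -- all chain levels stay in `[1, kmax]`
      have hJs2 : 2 * J * s = 2 * (J * s) := mul_assoc 2 J s
      have hlev : ∀ j, j < J → 1 ≤ k + j * s ∧ k + j * s ≤ kmax := by
        intro j hj
        refine ⟨by omega, ?_⟩
        have : j * s ≤ J * s := Nat.mul_le_mul_right s hj.le
        omega
      have hθk : θ k = ∑ j ∈ Finset.range J, w (k + j * s) := by
        simp only [θ, hk0, if_false]
        refine Finset.sum_congr rfl fun j hj => ?_
        simp only [g, hlev j (Finset.mem_range.1 hj), and_self, if_true]
      have hfr : ∀ j, j < J → (2 * m + 1) * 𝔟.b ^ (k + (j + 1) * s) + 3 ≤ 2 * L + 1 ∧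
          (L : ℤ) + 2 * R + 2 + 2 * (𝔟.b : ℤ) ^ (k + (j + 1) * s) ≤ 2 * L + 1 := fun j hj =>
        guarded_deep_fits 𝔟 hm hK2 hRL hkd (by omega) hj
      have hG' : ∀ j, j < J → ∀ (z : Fin 4 → ℤ) (μ ν : Fin 4) (h : μ < ν) (η : LGConfig 4 (Matrix.specialUnitaryGroup (Fin N) ℂ)),
          kerE (Matrix.specialUnitaryGroup (Fin N) ℂ) (fundamentalLatticeRep N) β
            (fun c => (𝔟.b : ℤ) ^ (k + (j + 1) * s) * (z c / (𝔟.b : ℤ) ^ s - m)) ((2 * m + 1) * 𝔟.b ^ (k + (j + 1) * s)) η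
            ((largeFieldEvent (N := N) 𝔟 (ρ ^ j * ε k) ⟨k + j * s, z, μ, ν, h⟩ \
              largeFieldEvent (N := N) 𝔟 (ρ * (ρ ^ j * ε k)) ⟨k + (j + 1) * s, fun c => z c / (𝔟.b : ℤ) ^ s, μ, ν, h⟩).indicator
                fun _ => (1 : ℝ)) ≤ w (k + j * s) := by
        intro j hj z μ ν h η
        have hG := hGUCR (k + j * s) (hlev j hj).1 (ρ ^ j * ε k) (sched_pow hρ hsched k j) z μ ν h η
        have e1 : k + j * s + s = k + (j + 1) * s := by ring
        rw [e1] at hG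
        exact hG
      have hsmall : ∀ γ ∈ (familyShell 𝔟 kmax R x).filter (fun γ => γ.k = k), ∀ j, j < J →
          16 * ((𝔟.b : ℝ) ^ ((j + 1) * s)) ^ 4 * (256 * (2 * (m : ℝ) + 4) ^ 4) *
            ((J : ℝ) * ((2 : ℝ) ^ (d + 1) * 2 * ∑ i ∈ T, familyCoeff 𝔟 kmax R x i γ)) ≤ 1 := by
        intro γ hγ j hj
        have h1 := hacap γ
        rw [(Finset.mem_filter.1 hγ).2] at h1
        exact guarded_deep_small 𝔟 hm hK2 hkd hdeep hj (ha0 γ) h1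
      have h := guarded_slice_exp_moment_deep (N := N) β 𝔟 m hm s J hJ ρ (ε k) kmax R L k x hred T
        (fun j hj => (hfr j hj).1) (fun j hj => (hfr j hj).2) w hw0 hG' hc
        (fun γ hγ j hj => by simpa only [mul_assoc] using hsmall γ hγ j hj)
      rw [hθk, show (2 : ℝ) ^ (d + 1) * (cD * (∑ j ∈ Finset.range J, w (k + j * s)) * (T.card : ℝ)) =
        (2 : ℝ) ^ (d + 1) * 2 * ((Real.exp 1 - 1) * 1536 * (∑ j ∈ Finset.range J, w (k + j * s)) * T.card) by rw [hcDdef]; ring]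
      exact h
  have key := integral_exp_two_mul_sum_le_of_levels μT Jf hJfm hJfb kmax K hKle hzero C hmom
  refine key.trans (Real.exp_le_exp.2 ?_)
  have hCle : ∀ d ∈ Finset.range (K + 1), C d ≤ 3072 * (J : ℝ) * T.card * (if d ≤ dtr then 1 else 0) + cD * T.card * θ (K - d) := by
    intro d _
    by_cases htop : d ≤ dtr
    · have h1 : C d = 3072 * (J : ℝ) * T.card := if_pos htop
      rw [h1, if_pos htop, mul_one]
      have := mul_nonneg (mul_nonneg hcD0 hT0) (hθ0 (K - d))
      linarith
    · have h1 : C d = cD * θ (K - d) * T.card := if_neg htop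
      rw [h1, if_neg htop, mul_zero, zero_add]
      exact le_of_eq (by ring)
  refine (Finset.sum_le_sum hCle).trans ?_
  rw [Finset.sum_add_distrib, ← Finset.mul_sum, ← Finset.mul_sum]
  have hcount : ∑ d ∈ Finset.range (K + 1), (if d ≤ dtr then (1 : ℝ) else 0) ≤ (m : ℝ) + 4 + 2 * J * s + J := by
    rw [Finset.sum_boole]
    have : ((Finset.range (K + 1)).filter (fun d => d ≤ dtr)).card ≤ dtr + 1 :=
      (Finset.card_le_card fun d hd => Finset.mem_range.2 (by have := (Finset.mem_filter.1 hd).2; omega)).trans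
        (Finset.card_range (dtr + 1)).le
    have h2 : (((Finset.range (K + 1)).filter (fun d => d ≤ dtr)).card : ℝ) ≤ ((dtr + 1 : ℕ) : ℝ) := by exact_mod_cast this
    refine h2.trans (le_of_eq ?_)
    rw [hdtr]; push_cast; ring
  have hθsum : ∑ d ∈ Finset.range (K + 1), θ (K - d) ≤ δ₀ + J * Wsum := by
    rw [← Finset.sum_range_reflect (fun d => θ (K - d)) (K + 1)]
    simp only [add_tsub_cancel_right]
    have h2 : ∀ d ∈ Finset.range (K + 1), θ (K - (K - d)) = θ d := fun d hd => by
      rw [Nat.sub_sub_self (Nat.lt_succ_iff.1 (Finset.mem_range.1 hd))]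
    rw [Finset.sum_congr rfl h2, Finset.sum_range_succ']
    show ((∑ k ∈ Finset.range K, θ (k + 1)) + θ 0) ≤ δ₀ + J * Wsum
    have h0 : θ 0 = δ₀ := if_pos rfl
    have h1 : ∀ i, θ (i + 1) = ∑ j ∈ Finset.range J, g (i + 1 + j * s) := fun i => if_neg (Nat.succ_ne_zero i)
    rw [h0, Finset.sum_congr rfl fun i _ => h1 i, add_comm, Finset.sum_comm]
    refine add_le_add le_rfl ?_
    calc ∑ j ∈ Finset.range J, ∑ i ∈ Finset.range K, g (i + 1 + j * s)
        ≤ ∑ _j ∈ Finset.range J, Wsum := Finset.sum_le_sum fun j _ =>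
          (sum_shift_window_le g hg0 K (j * s)).trans (hgle _)
      _ = J * Wsum := by rw [Finset.sum_const, Finset.card_range, nsmul_eq_mul]
  have h3072 : (0 : ℝ) ≤ 3072 * (J : ℝ) * T.card := by positivity
  have hcDT : 0 ≤ cD * T.card := mul_nonneg hcD0 hT0
  calc 3072 * (J : ℝ) * (T.card : ℝ) * ∑ d ∈ Finset.range (K + 1), (if d ≤ dtr then (1 : ℝ) else 0) +
        cD * T.card * ∑ d ∈ Finset.range (K + 1), θ (K - d)
      ≤ 3072 * (J : ℝ) * (T.card : ℝ) * ((m : ℝ) + 4 + 2 * J * s + J) + cD * T.card * (δ₀ + J * Wsum) :=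
        add_le_add (mul_le_mul_of_nonneg_left hcount h3072) (mul_le_mul_of_nonneg_left hθsum hcDT)
    _ = (3072 * (J : ℝ) * ((m : ℝ) + 4 + 2 * J * s + J) + cD * (δ₀ + J * Wsum)) * T.card := by ring

end Guarded

end Summit.QuantumFields.YangMills.Cruxes.UVSeamRec.DLRPeeling

end
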